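import Summits.QuantumFields.BalabanUV.Beta.D1BFx.NeedleProjLetters
import Summits.QuantumFields.BalabanUV.Beta.D1BFx.GluonNeedleSplit
import Summits.QuantumFields.BalabanUV.Beta.D1BFx.NeedleGhostBubble2Row
import Summits.QuantumFields.BalabanUV.Beta.D1BFx.LatticeHLSRadial
import Summits.QuantumFields.BalabanUV.Beta.D1BFx.BlockColumnPoisson

/-!
# `BalabanUV.Beta.D1BFx.NeedleProjProjRow` — road «BF-x» for binder row D1, slot (K), END row `hGrp gN`, «GN-33 ∕ PP»: THE `projPiece ⊗ projPiece` CELL OF THE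
# GLUON NEEDLE ROW T₃ IS n-UNIFORM — `|Σ_b n⁻⁴·fullSum (w ↦ w_μw_ν·biBubbleTable (Ga)(Ga) projPiece projPiece μ ν (b+w) b)| ≤ C_PP` for every `n ≥ 1`, ONE
# `C_PP ≥ 0`, modulo [B5, Prop. 1.2] ∧ [B5, (1.126)–(1.127)] BY NAME — the FIRST of the nine `SbRblk ⊗ SbRblk` cells (an3-g57 §3′ (4) «R1⊗R1 (projector jets,
# every bond): … terms `k n⁻⁶·e^{−δ|w|/n}` and `k A₀·n⁻⁴·nrm(w)⁻²` ⇒ `Σ_w|w|²(…) = k·n⁰ + kA₀·n⁰`: n⁰ (the second is the saturated marginal sum again)»)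

HONEST DEPENDENCY (cell records, verbatim): «continuum YM on T⁴ ⇐ BetaPertH ∧ nine spine estimates (0/9 proved); BetaPertH ⇐ (D1) ∧ (D4) ∧
CAP+tail; G-an2-4 gates asym, D1 and NE2/3/4.»  HONEST FRAMING (cell contract, verbatim): «discharging `BetaPertH` makes Bałaban's UV stability
UNCONDITIONAL — a real constructive-QFT result; it is NOT the continuum limit and NOT the Clay problem.»  THIS MODULE DISCHARGES NOTHING of the
wall: [folklore] lattice bookkeeping BY NAME over the owner's «GN-𝔅» word shape `RankOneBubbleJets.bubble_dJetSw_dJetSw` (p260851), the owner's letters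
`NeedleProjLetters.exists_applyK_colGrad_le` ∕ `exists_applyKT_rowGrad_le` ∕ `exists_pairing_colGrad_rowGrad_le` ∕ `exists_pairing_rowGrad_colGrad_le` (kC·n⁻³, kP·n⁻⁴),
leaf-03's (L1) `GluonLegTails.Kinf_entry_le_of_prop12`, gan24-leaf-05's `NeedleGhostBubble2Row.tsum_weight_le_of_blockDecay_mass` and leaf-04-g9's
`LatticeHLSRadial.sum_pow_mul_exp_scale_le`.  No `def`, no `def … : Prop`, nothing cited, 0 sorry; the printed statements are HYPOTHESES by name.
Root-level binders hW ∕ hR-sockets ∕ hSX-socket ∕ D1Tel ∕ D1Rep — 0 discharged; (K) NOT closed; NOT D1, NOT `BetaPertH`, NOT continuum, NOT Clay.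

ABSOLUTE RULE (cell charter, verbatim): «No internally-minted statement may enter as a cited fact. Every hypothesis is either kernel-proved in
this package or a verbatim quotation of a PUBLISHED theorem with page reference. The manuscript(s) under audit are NOT citable for their own
disputed steps — they are the thing under adjudication; programme-internal (2001/route/tribunal) claims are never citable.»

WHY (owner `GLUON-NEEDLE-ROWS.md` v0.1 «GN-33» + MINE journal 2026-08-21T10:26Z; `GluonNeedleSplit.biBubbleTable_SbRblk_SbRblk_eq`: the nine words of
T₃ after `prefactor₃_eq` (`ωgl·cR²·n⁻⁸ = 2N²`): THIS is the `proj ⊗ proj` word, sign `+`).  By `bubble_dJetSw_dJetSw` the word at `(b+w, b)` is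
`−½·[(Ga c′)(b+w,μ)·(Ga c)(b,ν) − Ga(b+w,b)_{μν}·⟨Ga c, r′⟩ − ⟨r, Ga c′⟩·Ga(b,b+w)_{νμ} + (r Ga)(b,ν)·(r′ Ga)(b+w,μ)]`, `c = ∇_col P(·,b+w+e_μ)`,
`r = ∇_row P(b+w+e_μ,·)`, `c′`, `r′` at `b+e_ν`; with the letters: `≤ (kC∕n³)²·e^{−δ₁·dist(blk(b+w), blk(b+e_ν))} + (kP∕n⁴)·|Ga(b+w,b)_{μν}|`; the (1.22)
sum of the first shape is `≤ k²n⁻⁶·e^{δ₁}·n²(1+4∕δ₁)²·n⁴·K₄(δ₁∕2)` (block decay, F ≡ 1, m = n⁴) and of the second `≤ kP n⁻⁴·A₀·Σ_w e^{−(δ∕n)‖w‖} ≤ kP n⁻⁴·A₀·C(δ)·n⁴`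
(`|w_μw_ν| ≤ ‖w‖∞²` cancels the Coulomb profile EXACTLY — the saturated marginal sum); the base average `Σ_b n⁻⁴` is convex.  All n-powers cancel: n⁰.

CONTENT (`a > 0`, `n ≥ 1`).
* §1 [folklore] `abs_weight_le_sq` (`|w_μ·w_ν| ≤ ‖w‖∞²`), **`abs_projProj_word_le`** — the pointwise bound from ABSTRACT letters (KC with block decay, KP, any legs' symmetry).
* §2 [folklore] **`abs_fullSum_projProj_le`** — the (1.22) sum at one base site from abstract letters + an entry profile `A₀e^{−(δ∕n)‖w‖}∕‖w‖²` of `Ga`: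
  `≤ KC²·e^{δ₁}·(n²·((1+4∕δ₁)²·(n⁴·K₄(δ₁∕2)))) + KP·A₀·(1 + C₀(δ))·n⁴`, `C₀(δ) = 1296·(2∕δ)³·(1+2∕δ)`.
* §3 [folklore] **`exists_projProj_row_le`** — `∃ C ≥ 0, ∀ n [NeZero n], |Σ_{b ∈ image resSite} n⁻⁴·fullSum (…)| ≤ C` modulo `h12`∕`h126` (letters instantiated:
  `KC = kC∕n³`, `KP = kP∕n⁴`).
NOT HERE (honest): the other eight cells of `SbRblk ⊗ SbRblk` (the dipole∕needle pieces need (L3)); T₁∕T₂; the `h₃` glue.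
Unit `b2b-balaban-beta-d1-p2` (gen 10), road «BF-x» OWNER; `LEAVES-BFx.md` row (N) «GN-33∕PP».
-/

namespace Summit.QuantumFields.BalabanUV.Beta.D1BFx.NeedleProjProjRow

open Finset Real
open scoped BigOperators
open Literature.MathematicalPhysics.QuantumFieldTheory.Balaban1983to89
open Literature.MathematicalPhysics.QuantumFieldTheory.Balaban1983to89.Beta
open B12Sec2to5 (l1 l1_nonneg summable_exp_neg_l1)
open B4Sect5Proof (latticeConst latticeConst_nonneg)
open B6QGQLower276 (X e blk B mem_B)
open B6QGQDecay237 (card_B)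
open ExpKernelCalculus (Site MKer Decays bubble)
open DyadicShell (Pt supNorm toReal toReal_apply natAbs_le_supNorm)
open WindowIdentification (fullSum fullSum_eq_tsum_sub)
open DressedMomentNormalisation (resSite)
open AffineAveraging (unitVec)
open VectorTailsLoc (fam kfam)
open Summit.QuantumFields.BalabanUV.Beta.TameKernelCalculus (Spr)
open Summit.QuantumFields.BalabanUV.Beta.D1BFx.PackedKernelSplit (biBubble bubble_eq_biBubble)
open Summit.QuantumFields.BalabanUV.Beta.D1BFx.FineHessianSectors (biBubbleTable biBubbleTable_apply)
open Summit.QuantumFields.BalabanUV.Beta.D1BFx.RProjector (Pgt Pgt_symm deltaPP deltaPP_pos)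
open Summit.QuantumFields.BalabanUV.Beta.D1BFx.RJetProjector (decays_Pgt)
open Summit.QuantumFields.BalabanUV.Beta.D1BFx.GluonLeg (Ga Ga_apply Ga_symm)
open Summit.QuantumFields.BalabanUV.Beta.D1BFx.GluonLegTails (Kinf_entry_le_of_prop12 spr_Ga_of_prop12 l1_le_four_mul_supNorm)
open Summit.QuantumFields.BalabanUV.Beta.D1BFx.GhostLeg (cast_pred_add_one)
open Summit.QuantumFields.BalabanUV.Beta.D1BFx.GhostLegFree (supNorm_eq)
open Summit.QuantumFields.BalabanUV.Beta.D1BFx.FrozenLegTails (nOf MOf hn1)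
open Summit.QuantumFields.BalabanUV.Beta.D1BFx.GluonNeedleSplit (projPiece projPiece_apply)
open Summit.QuantumFields.BalabanUV.Beta.D1BFx.RankOneBubble (applyK applyKT pairing)
open Summit.QuantumFields.BalabanUV.Beta.D1BFx.RankOneBubbleJets (colGrad rowGrad bubble_dJetSw_dJetSw)
open Summit.QuantumFields.BalabanUV.Beta.D1BFx.NeedleProjLetters (exists_applyK_colGrad_le exists_applyKT_rowGrad_le exists_pairing_colGrad_rowGrad_le
  exists_pairing_rowGrad_colGrad_le unitVec_eq_e')
open Summit.QuantumFields.BalabanUV.Beta.D1BFx.NeedleGhostBubble2Row (tsum_weight_le_of_blockDecay_mass)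
open Summit.QuantumFields.BalabanUV.Beta.D1BFx.LatticeHLSRadial (sum_pow_mul_exp_scale_le)
open Summit.QuantumFields.BalabanUV.Beta.D1BFx.BlockColumnPoisson (dist_blk_le_one)

noncomputable section

/-! ## §1 The pointwise bound of the `proj ⊗ proj` word from abstract letters -/

/-- [folklore] `|w_μ·w_ν| ≤ ‖w‖∞²`. -/
theorem abs_weight_le_sq (w : Pt) (μ ν : Fin 4) : |toReal w μ * toReal w ν| ≤ (supNorm w : ℝ) ^ 2 := by
  have h : ∀ i : Fin 4, |toReal w i| ≤ (supNorm w : ℝ) := fun i => by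
    have h1 : ((w i).natAbs : ℝ) ≤ (supNorm w : ℝ) := by exact_mod_cast natAbs_le_supNorm w i
    have h2 : |toReal w i| = ((w i).natAbs : ℝ) := by
      rw [toReal_apply, Nat.cast_natAbs, Int.cast_abs]
    rw [h2]; exact h1
  rw [abs_mul, sq]
  exact mul_le_mul (h μ) (h ν) (abs_nonneg _) (Nat.cast_nonneg _)

variable (n : ℕ) [NeZero n] (a : ℝ)

/-- [folklore] **THE `proj ⊗ proj` WORD, POINTWISE, FROM ABSTRACT LETTERS**: over a spread leg `Ga` (any `a > 0`), with point-value letters `KC` (block decay `δ₁`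
from the column site) for `Ga ∇_col P` ∕ `∇_row P Ga` and pairing letters `KP`:
`|biBubbleTable (Ga)(Ga) projPiece projPiece μ ν (b+w) b| ≤ KC²·e^{−δ₁·dist(blk(b+w), blk(b+e_ν))} + KP·|Ga (b+w) b μ ν|`. -/
theorem abs_projProj_word_le (ha : 0 < a) (hA : Spr (Ga n a)) {KC KP δ₁ : ℝ} (hKC0 : 0 ≤ KC) (hδ₁ : 0 ≤ δ₁)
    (hKC : ∀ (q x : Pt) (α : Fin 4), |applyK (Ga n a) (colGrad (Pgt n a) q) x α| ≤ KC * Real.exp (-(δ₁ * dist (blk (n - 1) x) (blk (n - 1) q))))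
    (hKT : ∀ (p z : Pt) (β : Fin 4), |applyKT (rowGrad (Pgt n a) p) (Ga n a) z β| ≤ KC * Real.exp (-(δ₁ * dist (blk (n - 1) z) (blk (n - 1) p))))
    (hKP : ∀ q p : Pt, |pairing (applyK (Ga n a) (colGrad (Pgt n a) q)) (rowGrad (Pgt n a) p)| ≤ KP)
    (hKP' : ∀ q p : Pt, |pairing (rowGrad (Pgt n a) p) (applyK (Ga n a) (colGrad (Pgt n a) q))| ≤ KP)
    (μ ν : Fin 4) (b w : Pt) :
    |biBubbleTable (Ga n a) (Ga n a) (projPiece n a) (projPiece n a) μ ν (b + w) b|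
      ≤ KC * KC * Real.exp (-(δ₁ * dist (blk (n - 1) (b + w)) (blk (n - 1) (b + unitVec ν)))) + KP * |Ga n a (b + w) b μ ν| := by
  have hn : (0 : ℝ) < n := by exact_mod_cast Nat.pos_of_ne_zero (NeZero.ne n)
  have hP : Spr (Pgt n a) := ⟨_, _, div_pos (deltaPP_pos 4 ha) (mul_pos (by norm_num) hn), decays_Pgt n a ha⟩
  rw [biBubbleTable_apply, projPiece_apply, projPiece_apply, ← bubble_eq_biBubble, bubble_dJetSw_dJetSw hA hP hP μ ν (b + w) b]
  -- the four terms
  set T₁ := applyK (Ga n a) (colGrad (Pgt n a) (b + unitVec ν)) (b + w) μ with hT₁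
  set T₂ := applyK (Ga n a) (colGrad (Pgt n a) (b + w + unitVec μ)) b ν with hT₂
  set G₁ := Ga n a (b + w) b μ ν with hG₁
  set P₁ := pairing (applyK (Ga n a) (colGrad (Pgt n a) (b + w + unitVec μ))) (rowGrad (Pgt n a) (b + unitVec ν)) with hP₁
  set P₂ := pairing (rowGrad (Pgt n a) (b + w + unitVec μ)) (applyK (Ga n a) (colGrad (Pgt n a) (b + unitVec ν))) with hP₂
  set G₂ := Ga n a b (b + w) ν μ with hG₂
  set T₃ := applyKT (rowGrad (Pgt n a) (b + w + unitVec μ)) (Ga n a) b ν with hT₃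
  set T₄ := applyKT (rowGrad (Pgt n a) (b + unitVec ν)) (Ga n a) (b + w) μ with hT₄
  set E := Real.exp (-(δ₁ * dist (blk (n - 1) (b + w)) (blk (n - 1) (b + unitVec ν)))) with hE
  have hE0 : 0 ≤ E := (Real.exp_pos _).le
  have h1 : |T₁| ≤ KC * E := hKC (b + unitVec ν) (b + w) μ
  have h2 : |T₂| ≤ KC := (hKC (b + w + unitVec μ) b ν).trans (mul_le_of_le_one_right hKC0 (by
    rw [Real.exp_le_one_iff]; have : 0 ≤ δ₁ * dist (blk (n - 1) b) (blk (n - 1) (b + w + unitVec μ)) := by positivity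
    linarith))
  have h3 : |T₃| ≤ KC := (hKT (b + w + unitVec μ) b ν).trans (mul_le_of_le_one_right hKC0 (by
    rw [Real.exp_le_one_iff]; have : 0 ≤ δ₁ * dist (blk (n - 1) b) (blk (n - 1) (b + w + unitVec μ)) := by positivity
    linarith))
  have h4 : |T₄| ≤ KC * E := hKT (b + unitVec ν) (b + w) μ
  have hp1 : |P₁| ≤ KP := hKP _ _
  have hp2 : |P₂| ≤ KP := hKP' _ _
  have hG : |G₂| = |G₁| := by rw [hG₂, hG₁, Ga_symm n a NeZero.one_le ha b (b + w) ν μ]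
  have e1 : |T₁ * T₂| ≤ KC * E * KC := by rw [abs_mul]; exact mul_le_mul h1 h2 (abs_nonneg _) (by positivity)
  have e2 : |G₁ * P₁| ≤ |G₁| * KP := by rw [abs_mul]; exact mul_le_mul_of_nonneg_left hp1 (abs_nonneg _)
  have e3 : |P₂ * G₂| ≤ KP * |G₁| := by rw [abs_mul, hG]; exact mul_le_mul_of_nonneg_right hp2 (abs_nonneg _)
  have e4 : |T₃ * T₄| ≤ KC * (KC * E) := by rw [abs_mul]; exact mul_le_mul h3 h4 (abs_nonneg _) hKC0
  calc |-(1 / 2 : ℝ) * (T₁ * T₂ - G₁ * P₁ - (P₂ * G₂ - T₃ * T₄))|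
      = (1 / 2) * |T₁ * T₂ - G₁ * P₁ - (P₂ * G₂ - T₃ * T₄)| := by
        rw [abs_mul, abs_neg, abs_of_pos (by norm_num : (0 : ℝ) < 1 / 2)]
    _ ≤ (1 / 2) * (|T₁ * T₂| + |G₁ * P₁| + (|P₂ * G₂| + |T₃ * T₄|)) := by
        refine mul_le_mul_of_nonneg_left ?_ (by norm_num)
        exact (abs_sub _ _).trans (add_le_add (abs_sub _ _) (abs_sub _ _))
    _ ≤ (1 / 2) * (KC * E * KC + |G₁| * KP + (KP * |G₁| + KC * (KC * E))) := by gcongr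
    _ = KC * KC * E + KP * |G₁| := by ring

/-! ## §2 The (1.22) sum at one base site -/

omit [NeZero n] in
/-- [folklore] adjacent sites lie in the same or adjacent blocks: `dist (blk (n−1) (b + e_ν)) (blk (n−1) b) ≤ 1`. -/
theorem dist_blk_add_unitVec_le (b : Pt) (ν : Fin 4) : dist (blk (n - 1) (b + unitVec ν)) (blk (n - 1) b) ≤ 1 := by
  refine dist_blk_le_one fun i => ?_
  have h0 : (0 : ℤ) ≤ ((n - 1 : ℕ) : ℤ) := by positivity
  simp only [Pi.add_apply, add_sub_cancel_left, AffineAveraging.unitVec_apply]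
  split_ifs
  · rw [abs_one]; linarith
  · rw [abs_zero]; linarith

/-- [folklore] the scale-`n` damped lattice sum in the road's `Pt` currency: `Σ_{w ∈ S} e^{−(δ∕n)‖w‖∞} ≤ (1 + C₀(δ))·n⁴`,
`C₀(δ) = 216·(3!·(2∕δ)³·(1 + 2∕δ))` (leaf-04-g9's `sum_pow_mul_exp_scale_le` at `q = 0`, `d = 4`). -/
theorem sum_exp_scale_le {δ : ℝ} (hδ : 0 < δ) (S : Finset Pt) :
    ∑ w ∈ S, Real.exp (-(δ / n) * supNorm w) ≤ (1 + 1296 * ((2 / δ) ^ 3 * (1 + 2 / δ))) * (n : ℝ) ^ 4 := by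
  have hn1 : (1 : ℝ) ≤ n := by exact_mod_cast NeZero.one_le
  have h := sum_pow_mul_exp_scale_le (d := 4) (by norm_num) hδ (NeZero.one_le (n := n)) 0 S 0
  simp only [sub_zero, pow_zero, one_mul] at h
  have h4 : (1 : ℝ) ≤ (n : ℝ) ^ 4 := one_le_pow₀ hn1
  have e : ∑ w ∈ S, Real.exp (-(δ / n) * supNorm w) = ∑ x ∈ S, Real.exp (-(δ / n) * (Beta.PoissonInterior.supNorm x : ℝ)) :=
    Finset.sum_congr rfl fun w _ => by rw [supNorm_eq]
  rw [e]
  have key : ∀ X : ℝ, X = 1296 * ((2 / δ) ^ 3 * (1 + 2 / δ)) →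
      (∑ x ∈ S, Real.exp (-(δ / n) * (Beta.PoissonInterior.supNorm x : ℝ)) ≤ 1 + X * (n : ℝ) ^ (0 + 4)) →
      ∑ x ∈ S, Real.exp (-(δ / n) * (Beta.PoissonInterior.supNorm x : ℝ)) ≤ (1 + 1296 * ((2 / δ) ^ 3 * (1 + 2 / δ))) * (n : ℝ) ^ 4 := by
    intro X hX h'
    subst hX
    have e4 : (n : ℝ) ^ (0 + 4) = (n : ℝ) ^ 4 := by norm_num
    rw [e4] at h'
    have hC : 0 ≤ 1296 * ((2 / δ) ^ 3 * (1 + 2 / δ)) := by positivity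
    nlinarith
  exact key _ (by push_cast; norm_num [Nat.factorial]; ring) h

/-- [folklore] **THE (1.22) SUM OF THE `proj ⊗ proj` WORD AT ONE BASE SITE, FROM ABSTRACT LETTERS**: with the letters of §1 and an entry profile
`|Ga (b+w) b μ ν| ≤ A₀·e^{−(δ∕n)‖w‖∞}∕‖w‖∞²` (`w ≠ 0`): `|fullSum (w ↦ w_μw_ν·word(b,w))| ≤ KC²·e^{δ₁}·(n²·((1+4∕δ₁)²·(n⁴·K₄(δ₁∕2)))) + KP·A₀·(1+C₀(δ))·n⁴`. -/
theorem abs_fullSum_projProj_le (ha : 0 < a) (hA : Spr (Ga n a)) {KC KP δ₁ A₀ δ : ℝ} (hKC0 : 0 ≤ KC) (hKP0 : 0 ≤ KP) (hδ₁ : 0 < δ₁) (hA₀ : 0 ≤ A₀)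
    (hδ : 0 < δ)
    (hKC : ∀ (q x : Pt) (α : Fin 4), |applyK (Ga n a) (colGrad (Pgt n a) q) x α| ≤ KC * Real.exp (-(δ₁ * dist (blk (n - 1) x) (blk (n - 1) q))))
    (hKT : ∀ (p z : Pt) (β : Fin 4), |applyKT (rowGrad (Pgt n a) p) (Ga n a) z β| ≤ KC * Real.exp (-(δ₁ * dist (blk (n - 1) z) (blk (n - 1) p))))
    (hKP : ∀ q p : Pt, |pairing (applyK (Ga n a) (colGrad (Pgt n a) q)) (rowGrad (Pgt n a) p)| ≤ KP)
    (hKP' : ∀ q p : Pt, |pairing (rowGrad (Pgt n a) p) (applyK (Ga n a) (colGrad (Pgt n a) q))| ≤ KP)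
    (hprof : ∀ (b w : Pt) (κ l : Fin 4), w ≠ 0 → |Ga n a (b + w) b κ l| ≤ A₀ * Real.exp (-(δ / n) * supNorm w) / (supNorm w : ℝ) ^ 2)
    (μ ν : Fin 4) (b : Pt) :
    |fullSum (fun w : Pt => toReal w μ * toReal w ν * biBubbleTable (Ga n a) (Ga n a) (projPiece n a) (projPiece n a) μ ν (b + w) b)|
      ≤ KC * KC * Real.exp δ₁ * ((n : ℝ) ^ 2 * ((1 + 4 / δ₁) ^ 2 * ((n : ℝ) ^ 4 * latticeConst 4 (δ₁ / 2))))
        + KP * A₀ * ((1 + 1296 * ((2 / δ) ^ 3 * (1 + 2 / δ))) * (n : ℝ) ^ 4) := by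
  have hn : (0 : ℝ) < n := by exact_mod_cast Nat.pos_of_ne_zero (NeZero.ne n)
  have hmn : (((n - 1 : ℕ) : ℝ) + 1) = n := cast_pred_add_one n
  set f : Pt → ℝ := fun w => biBubbleTable (Ga n a) (Ga n a) (projPiece n a) (projPiece n a) μ ν (b + w) b with hf
  set K : Pt → ℝ := fun w => toReal w μ * toReal w ν * f w with hK
  -- shape 1: block decay from the base block, F ≡ 1
  set M₁ : ℝ := KC * KC * Real.exp δ₁ with hM₁
  have hM₁0 : 0 ≤ M₁ := by positivity
  set f₁ : Pt → ℝ := fun w => M₁ * Real.exp (-(δ₁ * dist (blk (n - 1) (b + w)) (blk (n - 1) b))) with hf₁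
  have hblk1 : ∀ β' : Site 4, ∑ _u ∈ B (n - 1) β', (1 : ℝ) ≤ (n : ℝ) ^ 4 := fun β' => by
    rw [Finset.sum_const, nsmul_eq_mul, mul_one, card_B, hmn]
  have hf₁le : ∀ w : Pt, |f₁ w| ≤ M₁ * Real.exp (-(δ₁ * dist (blk (n - 1) (b + w)) (blk (n - 1) b))) * (fun _ : Site 4 => (1 : ℝ)) (b + w) := fun w => by
    rw [hf₁, abs_of_nonneg (by positivity)]; simp
  obtain ⟨hs₁, ht₁⟩ := tsum_weight_le_of_blockDecay_mass n (f := f₁) (F := fun _ => (1 : ℝ)) hM₁0 hδ₁ (fun _ => zero_le_one) hblk1 b μ ν hf₁le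
  -- shape 2: the scale-n damped sum (the Coulomb profile is cancelled by the weight)
  set g₂ : Pt → ℝ := fun w => KP * A₀ * Real.exp (-(δ / n) * supNorm w) with hg₂
  have hg₂0 : ∀ w, 0 ≤ g₂ w := fun w => by positivity
  have hfin₂ : ∀ S : Finset Pt, ∑ w ∈ S, g₂ w ≤ KP * A₀ * ((1 + 1296 * ((2 / δ) ^ 3 * (1 + 2 / δ))) * (n : ℝ) ^ 4) := by
    intro S
    rw [hg₂, ← Finset.mul_sum]
    exact mul_le_mul_of_nonneg_left (sum_exp_scale_le n hδ S) (by positivity)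
  have hs₂ : Summable g₂ := summable_of_sum_le hg₂0 hfin₂
  have ht₂ := hs₂.tsum_le_of_sum_le hfin₂
  -- domination of the summand
  have hdom : ∀ w : Pt, |K w| ≤ |toReal w μ * toReal w ν * f₁ w| + g₂ w := by
    intro w
    have hpt := abs_projProj_word_le n a ha hA hKC0 hδ₁.le hKC hKT hKP hKP' μ ν b w
    -- the first shape: move the decay to the base block
    have hd : dist (blk (n - 1) (b + w)) (blk (n - 1) b) ≤ dist (blk (n - 1) (b + w)) (blk (n - 1) (b + unitVec ν)) + 1 :=
      (dist_triangle _ (blk (n - 1) (b + unitVec ν)) _).trans (add_le_add le_rfl (dist_blk_add_unitVec_le n b ν))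
    have hexp : Real.exp (-(δ₁ * dist (blk (n - 1) (b + w)) (blk (n - 1) (b + unitVec ν))))
        ≤ Real.exp δ₁ * Real.exp (-(δ₁ * dist (blk (n - 1) (b + w)) (blk (n - 1) b))) := by
      rw [← Real.exp_add, Real.exp_le_exp]; nlinarith
    have hshape1 : KC * KC * Real.exp (-(δ₁ * dist (blk (n - 1) (b + w)) (blk (n - 1) (b + unitVec ν)))) ≤ f₁ w := by
      rw [hf₁, hM₁]
      calc KC * KC * Real.exp (-(δ₁ * dist (blk (n - 1) (b + w)) (blk (n - 1) (b + unitVec ν))))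
          ≤ KC * KC * (Real.exp δ₁ * Real.exp (-(δ₁ * dist (blk (n - 1) (b + w)) (blk (n - 1) b)))) :=
            mul_le_mul_of_nonneg_left hexp (by positivity)
        _ = _ := by ring
    have hf₁0 : 0 ≤ f₁ w := by rw [hf₁]; positivity
    -- the second shape: weight × profile
    have hshape2 : |toReal w μ * toReal w ν| * (KP * |Ga n a (b + w) b μ ν|) ≤ g₂ w := by
      by_cases hw : w = 0
      · subst hw
        have : toReal (0 : Pt) μ = 0 := by simp [toReal_apply]
        rw [this, zero_mul, abs_zero, zero_mul]; exact hg₂0 0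
      · have hN : (0 : ℝ) < (supNorm w : ℝ) := by exact_mod_cast DyadicShell.supNorm_pos hw
        have h1 := abs_weight_le_sq w μ ν
        have h2 := hprof b w μ ν hw
        calc |toReal w μ * toReal w ν| * (KP * |Ga n a (b + w) b μ ν|)
            ≤ (supNorm w : ℝ) ^ 2 * (KP * (A₀ * Real.exp (-(δ / n) * supNorm w) / (supNorm w : ℝ) ^ 2)) :=
              mul_le_mul h1 (mul_le_mul_of_nonneg_left h2 hKP0) (by positivity) (by positivity)
          _ = g₂ w := by rw [hg₂]; field_simp
    rw [hK, abs_mul, abs_mul (toReal w μ * toReal w ν) (f₁ w), abs_of_nonneg hf₁0]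
    calc |toReal w μ * toReal w ν| * |f w|
        ≤ |toReal w μ * toReal w ν| * (KC * KC * Real.exp (-(δ₁ * dist (blk (n - 1) (b + w)) (blk (n - 1) (b + unitVec ν)))) + KP * |Ga n a (b + w) b μ ν|) :=
          mul_le_mul_of_nonneg_left hpt (abs_nonneg _)
      _ = |toReal w μ * toReal w ν| * (KC * KC * Real.exp (-(δ₁ * dist (blk (n - 1) (b + w)) (blk (n - 1) (b + unitVec ν)))))
            + |toReal w μ * toReal w ν| * (KP * |Ga n a (b + w) b μ ν|) := by ring
      _ ≤ |toReal w μ * toReal w ν| * f₁ w + g₂ w := add_le_add (mul_le_mul_of_nonneg_left hshape1 (abs_nonneg _)) hshape2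
  -- summability and the bound
  have hsK : Summable K := Summable.of_norm_bounded (hs₁.add hs₂) fun w => by rw [Real.norm_eq_abs]; exact hdom w
  rw [fullSum_eq_tsum_sub _ hsK]
  have h0 : K 0 = 0 := by simp [hK, toReal_apply]
  rw [h0, sub_zero]
  have h1 : ‖∑' w : Pt, K w‖ ≤ ∑' w : Pt, (|toReal w μ * toReal w ν * f₁ w| + g₂ w) :=
    tsum_of_norm_bounded (hs₁.add hs₂).hasSum fun w => by rw [Real.norm_eq_abs]; exact hdom w
  rw [Real.norm_eq_abs] at h1
  refine h1.trans ?_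
  rw [hs₁.tsum_add hs₂]
  exact add_le_add ht₁ ht₂

/-! ## §3 The cell: base average, letters instantiated, n-powers cancelled -/

variable {n}

/-- [folklore] the base average is convex: `Σ_{b ∈ image resSite} n⁻⁴·C ≤ C` for `C ≥ 0`. -/
theorem sum_resSite_avg_le {C : ℝ} (hC : 0 ≤ C) :
    ∑ _b ∈ (univ : Finset (Fin 4 → Fin n)).image resSite, ((n : ℝ) ^ 4)⁻¹ * C ≤ C := by
  have hn : (0 : ℝ) < n := by exact_mod_cast Nat.pos_of_ne_zero (NeZero.ne n)
  rw [Finset.sum_const, nsmul_eq_mul]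
  have hcard : (((univ : Finset (Fin 4 → Fin n)).image resSite).card : ℝ) ≤ (n : ℝ) ^ 4 := by
    have h1 := Finset.card_image_le (s := (univ : Finset (Fin 4 → Fin n))) (f := resSite)
    have h2 : (univ : Finset (Fin 4 → Fin n)).card = n ^ 4 := by simp [Finset.card_univ, Fintype.card_fin]
    rw [h2] at h1
    exact_mod_cast h1
  calc (((univ : Finset (Fin 4 → Fin n)).image resSite).card : ℝ) * (((n : ℝ) ^ 4)⁻¹ * C)
      ≤ (n : ℝ) ^ 4 * (((n : ℝ) ^ 4)⁻¹ * C) := mul_le_mul_of_nonneg_right hcard (by positivity)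
    _ = C := by field_simp

/-- [folklore] **«GN-33 ∕ PP»: THE `projPiece ⊗ projPiece` CELL OF T₃ IS n-UNIFORM**, modulo [B5, Prop. 1.2] ∧ [B5, (1.126)–(1.127)] BY NAME: one `C ≥ 0` with
`|Σ_{b ∈ image resSite} n⁻⁴·fullSum (w ↦ w_μw_ν·biBubbleTable (Ga n a)(Ga n a) (projPiece n a) (projPiece n a) μ ν (b+w) b)| ≤ C` for every `n ≥ 1`. -/
theorem exists_projProj_row_le (ha : 0 < a) (h12 : B5.Prop12Printed (fam nOf hn1 MOf a ha)) (h126 : B5.Kernel126_127Printed (kfam nOf MOf)) (μ ν : Fin 4) :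
    ∃ C : ℝ, 0 ≤ C ∧ ∀ (n : ℕ) [NeZero n],
      |∑ b ∈ (univ : Finset (Fin 4 → Fin n)).image resSite, ((n : ℝ) ^ 4)⁻¹ *
        fullSum (fun w : Pt => toReal w μ * toReal w ν * biBubbleTable (Ga n a) (Ga n a) (projPiece n a) (projPiece n a) μ ν (b + w) b)| ≤ C := by
  obtain ⟨kC, δ₁, hδ₁, hkC, hKC⟩ := exists_applyK_colGrad_le a ha h12 h126
  obtain ⟨kT, δ₂, hδ₂, hkT, hKT⟩ := exists_applyKT_rowGrad_le a ha h12 h126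
  obtain ⟨kP, hkP, hKP⟩ := exists_pairing_colGrad_rowGrad_le a ha h12 h126
  obtain ⟨kP', hkP', hKP'⟩ := exists_pairing_rowGrad_colGrad_le a ha h12 h126
  obtain ⟨δ, A₀, hδ, hA₀, hprof⟩ := Kinf_entry_le_of_prop12 a ha h12 h126
  -- common letters: KC := max kC kT at rate min δ₁ δ₂, KP := max kP kP'
  set δm := min δ₁ δ₂ with hδm
  have hδm0 : 0 < δm := lt_min hδ₁ hδ₂
  set kM := max kC kT with hkM
  have hkM0 : 0 ≤ kM := hkC.trans (le_max_left _ _)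
  set kQ := max kP kP' with hkQ
  have hkQ0 : 0 ≤ kQ := hkP.trans (le_max_left _ _)
  set C₀ : ℝ := 1 + 1296 * ((2 / δ) ^ 3 * (1 + 2 / δ)) with hC₀
  refine ⟨kM * kM * Real.exp δm * ((1 + 4 / δm) ^ 2 * latticeConst 4 (δm / 2)) + kQ * A₀ * C₀,
    by have := latticeConst_nonneg 4 (half_pos hδm0).le; positivity, fun n _ => ?_⟩
  have hn : (0 : ℝ) < n := by exact_mod_cast Nat.pos_of_ne_zero (NeZero.ne n)
  have hA : Spr (Ga n a) := spr_Ga_of_prop12 (a := a) (ha := ha) h12 h126 n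
  -- the letters at this n, weakened to the common constants/rate
  have hexpm : ∀ {δ' : ℝ} (hle : δm ≤ δ') (t : ℝ), 0 ≤ t → Real.exp (-(δ' * t)) ≤ Real.exp (-(δm * t)) := fun hle t ht =>
    Real.exp_le_exp.2 (by nlinarith)
  have hKCn : ∀ (q x : Pt) (α : Fin 4), |applyK (Ga n a) (colGrad (Pgt n a) q) x α|
      ≤ kM / (n : ℝ) ^ 3 * Real.exp (-(δm * dist (blk (n - 1) x) (blk (n - 1) q))) := fun q x α =>
    (hKC n q x α).trans (mul_le_mul (div_le_div_of_nonneg_right (le_max_left _ _) (by positivity))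
      (hexpm (min_le_left _ _) _ dist_nonneg) (Real.exp_pos _).le (by positivity))
  have hKTn : ∀ (p z : Pt) (β : Fin 4), |applyKT (rowGrad (Pgt n a) p) (Ga n a) z β|
      ≤ kM / (n : ℝ) ^ 3 * Real.exp (-(δm * dist (blk (n - 1) z) (blk (n - 1) p))) := fun p z β =>
    (hKT n p z β).trans (mul_le_mul (div_le_div_of_nonneg_right (le_max_right _ _) (by positivity))
      (hexpm (min_le_right _ _) _ dist_nonneg) (Real.exp_pos _).le (by positivity))
  have hKPn : ∀ q p : Pt, |pairing (applyK (Ga n a) (colGrad (Pgt n a) q)) (rowGrad (Pgt n a) p)| ≤ kQ / (n : ℝ) ^ 4 := fun q p =>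
    (hKP n q p).trans (div_le_div_of_nonneg_right (le_max_left _ _) (by positivity))
  have hKPn' : ∀ q p : Pt, |pairing (rowGrad (Pgt n a) p) (applyK (Ga n a) (colGrad (Pgt n a) q))| ≤ kQ / (n : ℝ) ^ 4 := fun q p =>
    (hKP' n q p).trans (div_le_div_of_nonneg_right (le_max_right _ _) (by positivity))
  have hprofn : ∀ (b w : Pt) (κ l : Fin 4), w ≠ 0 → |Ga n a (b + w) b κ l| ≤ A₀ * Real.exp (-(δ / n) * supNorm w) / (supNorm w : ℝ) ^ 2 :=
    fun b w κ l hw => by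
      rw [Ga_symm n a NeZero.one_le ha (b + w) b κ l, Ga_apply]
      exact hprof n b w l κ hw
  -- one base site
  have hsite : ∀ b : Pt, |fullSum (fun w : Pt => toReal w μ * toReal w ν *
        biBubbleTable (Ga n a) (Ga n a) (projPiece n a) (projPiece n a) μ ν (b + w) b)|
      ≤ kM * kM * Real.exp δm * ((1 + 4 / δm) ^ 2 * latticeConst 4 (δm / 2)) + kQ * A₀ * C₀ := by
    intro b
    have h := abs_fullSum_projProj_le n a ha hA (KC := kM / (n : ℝ) ^ 3) (KP := kQ / (n : ℝ) ^ 4) (by positivity) (by positivity)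
      hδm0 hA₀ hδ hKCn hKTn hKPn hKPn' hprofn μ ν b
    refine h.trans (le_of_eq ?_)
    rw [hC₀]; field_simp
  -- the base average
  have hK0 : 0 ≤ kM * kM * Real.exp δm * ((1 + 4 / δm) ^ 2 * latticeConst 4 (δm / 2)) + kQ * A₀ * C₀ := by
    have := latticeConst_nonneg 4 (half_pos hδm0).le; positivity
  refine (Finset.abs_sum_le_sum_abs _ _).trans ?_
  calc ∑ b ∈ (univ : Finset (Fin 4 → Fin n)).image resSite, |((n : ℝ) ^ 4)⁻¹ *
        fullSum (fun w : Pt => toReal w μ * toReal w ν * biBubbleTable (Ga n a) (Ga n a) (projPiece n a) (projPiece n a) μ ν (b + w) b)|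
      ≤ ∑ _b ∈ (univ : Finset (Fin 4 → Fin n)).image resSite, ((n : ℝ) ^ 4)⁻¹ *
          (kM * kM * Real.exp δm * ((1 + 4 / δm) ^ 2 * latticeConst 4 (δm / 2)) + kQ * A₀ * C₀) := by
        refine Finset.sum_le_sum fun b _ => ?_
        rw [abs_mul, abs_of_nonneg (by positivity : (0 : ℝ) ≤ ((n : ℝ) ^ 4)⁻¹)]
        exact mul_le_mul_of_nonneg_left (hsite b) (by positivity)
    _ ≤ _ := sum_resSite_avg_le hK0

end

end Summit.QuantumFields.BalabanUV.Beta.D1BFx.NeedleProjProjRow
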